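import Summits.QuantumFields.YangMills.Theorems.BalabanUVNodesN15TwoSpacingGluingSecondOrder
import Summits.QuantumFields.YangMills.Theorems.BalabanUVNodesN15TwoSpacingGluingNode
import HarnessLib

/-!
# THE GLUING STEP AT TWO LATTICE SPACINGS, XIII: FILE 50's fourteen-row letter bundle `GluedLetters` of the two parametrix pairs ASSEMBLED FROM PER-CUBE ROWS — cube entries 0–3 at both
# spacings, their two-grid defects, the remainder's commutator rows (both arrangements) and their defects, the partition's size ∕ fit ∕ Leibniz data, and the overlap `N_ov`; so that
# `ne2PlusOperator_glued_of_letters` is ONE application away from per-cube data (dag-n15-c g11, FILE 55; N15 = NE2, s1 «background-layer OPERATOR ingredient»; generic — flat and covariant)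

Cell `pub-ymgap`, seat `pub-ymgap-dag-n15-c` (R134 (a); HUMAN RULING D-0062), generation 11.  `bears_on: R4∕N15 · K3⁷ SpineGivenEndpointR13SepCoPH (stmt-QuantumFields-20544)`.
Filed `--supports stmt-QuantumFields-20544 --as helper` — COUNT-NEUTRAL.  Theorems only (0 `def`, 0 `sorry`).  Imports BY NAME FILE 54 `…N15TwoSpacingGluingSecondOrder` (entry 3; through it
FILES 45∕48∕49∕53: `hasMaj_parametrix`, `hasMaj_remainder`, `hasMaj_remainderL`, `hasMaj_comp_parametrix`, `hasMaj_parametrix_comp`, the `idef` twins) and FILE 50 `…N15TwoSpacingGluingNode`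
(`GluedLetters`, `ne2PlusOperator_glued_of_letters`); nothing in the tree is modified.

WHY.  FILE 50 ★★★ `ne2PlusOperator_glued_of_letters` delivers the node's first conjunct `NE2PlusOperator` BY NAME from the bundle `GluedLetters blk π G₀ R R̃ D D₃ E G₀′ R′ R̃′ D′ D₃′ E′ A θ m r δ`
(14 rows about the two parametrix pairs).  THIS FILE builds that bundle from PER-CUBE rows in the localized currency `1_{S_□}(y)1_{S_□}(y′)·c·e^{−δd}` of FILES 45–54: ★★★
`gluedLetters_of_cubeRows` — given, for every cube `□`, at both spacings: the entries `G_□` (`β`), `D∘G_□` (`β₁`), `G_□∘E` (`β₂`), `D₃∘G_□` (`β₃`); the remainder rows `[Δ, M_{h_□}]∘G_□`,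
`G_□∘[Δ, M_{h_□}]` (`θ₀`) and `[D₃, M_{h_□}]∘G_□` (`θ₃`); the two-grid defects of all of these (`m₀, m₁, m₂, m₃, r₀, r₃`); the partition data `|h_□| ≤ 1`, fit `o`, the two-term Leibniz rules
of `D` (left: `h^s, dh` with sizes `c_s, c_d`, fits `o_s, o_d`) and of `E` (right), and the overlap `Σ_□ 1_{S_□} ≤ N_ov` — the bundle holds with
`A = N_ov(β + (c_sβ₁ + c_dβ) + (β₂c′_s + βc′_d) + (β₃ + θ₃))`, `θ = N_ovθ₀`, `m = N_ov·(sum of the four defect constants of FILES 45∕48∕54)`, `r = N_ov(θ₀o + r₀)`.  For the flat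
`Σ∇*∇ + W` the rows come from FILES 46∕49∕51 + g8 `mulOp_comp_fgrad…`; for the covariant `Δ_R + W` from FILES 52∕53 (`covD_comp_mulOp_scalar`, `mulOp_scalar_comp_covD`,
`hasMaj_commOp_covLapM_comp`, `hasMaj_comp_commOp_covLapM` and their `idef` twins).

HONEST FRAMING ∕ LIMITS.  Pure assembly (one `.mono` per row); [B6] (2.133)–(2.136) p.247, [B9] (3.42) p.397, p.399 = SHAPES ∕ MECHANISM; nothing asserted; every cube row stays
displayed.  NE2⁺ NOT PRINTED, NOT proved; N15 NOT discharged; counts of record UNMOVED (typed 28∕28 · discharged 5∕27); one finite 𝕋⁴ at fixed ε — NOT infinite volume, NOT OS on ℝ⁴,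
NOT a mass gap, NOT Clay; R4 closes the conditional finite-𝕋⁴ rung `BalabanLadder.UV` only.  Restate-immune (no Theses import).
-/

noncomputable section

namespace Summit.QuantumFields.YangMills.BalabanUVNodes.N15.Gluing

open Literature.MathematicalPhysics.QuantumFieldTheory.Balaban1983to89
open Literature.MathematicalPhysics.QuantumFieldTheory.Balaban1983to89.B11SectG (BlockNorm HasMaj)
open Literature.MathematicalPhysics.QuantumFieldTheory.Balaban1983to89.T4EtaRateDefect (idef)
open Literature.MathematicalPhysics.QuantumFieldTheory.Balaban1983to89.T4EtaRateCoeffDefect (pull)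
open Literature.MathematicalPhysics.QuantumFieldTheory.Balaban1983to89.B6Prop26Gluing (mulOp ind)

section Bundle

variable {X X' : Type} [Fintype X] [Fintype X'] {K : Type} [Fintype K] {g : B6.Geometry} (blk : X → g.Site) (π : X' → X) (S : K → Set g.Site)

omit [Fintype X] [Fintype X'] [Fintype K] in
/-- Monotonicity of the common majorant shape `N·x·e^{−δd}` in the constant. [folklore] -/
theorem const_mono_exp {Nov x x' δ : ℝ} (hNov : 0 ≤ Nov) (hx : x ≤ x') (y y' : g.Site) :
    Nov * x * Real.exp (-(δ * g.dist y y')) ≤ Nov * x' * Real.exp (-(δ * g.dist y y')) :=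
  mul_le_mul_of_nonneg_right (mul_le_mul_of_nonneg_left hx hNov) (Real.exp_nonneg _)

/-- ★★★ **THE LETTER BUNDLE FROM PER-CUBE ROWS.**  See the module docstring for the dictionary; the conclusion is FILE 50's `GluedLetters` for the parametrix pairs `(G₀, R, R̃) = (parametrix h G,
remainder Δ h G, remainderL Δ h G)` at both spacings, with the left factors `D, D₃` and the right factor `E` abstract (their Leibniz ∕ commutator data displayed).
[cite: Balaban1984PropagatorsII, (2.133)–(2.136) p.247 (shapes + mechanism); Balaban1985BackgroundPropagators, (3.42) p.397 (the four entries), p.399 (architecture)] -/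
theorem gluedLetters_of_cubeRows {Δ D D₃ E : (X → ℝ) →ₗ[ℝ] (X → ℝ)} {Δ' D' D₃' E' : (X' → ℝ) →ₗ[ℝ] (X' → ℝ)} {h hs dh hsE dhE : K → X → ℝ} {h' hs' dh' hsE' dhE' : K → X' → ℝ}
    {G : K → (X → ℝ) →ₗ[ℝ] (X → ℝ)} {G' : K → (X' → ℝ) →ₗ[ℝ] (X' → ℝ)} {β β₁ β₂ β₃ θ₀ θ₃ cs cd csE cdE o os od osE odE m₀ m₁ m₂ m₃ r₀ r₃ δ Nov : ℝ}
    (hβ : 0 ≤ β) (hβ₁ : 0 ≤ β₁) (hβ₂ : 0 ≤ β₂) (hβ₃ : 0 ≤ β₃) (hθ : 0 ≤ θ₀) (hθ₃ : 0 ≤ θ₃) (hcs : 0 ≤ cs) (hcd : 0 ≤ cd) (hcsE : 0 ≤ csE) (hcdE : 0 ≤ cdE) (ho : 0 ≤ o)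
    (hos : 0 ≤ os) (hod : 0 ≤ od) (hosE : 0 ≤ osE) (hodE : 0 ≤ odE) (hm₀ : 0 ≤ m₀) (hm₁ : 0 ≤ m₁) (hm₂ : 0 ≤ m₂) (hm₃ : 0 ≤ m₃) (hr₀ : 0 ≤ r₀) (hr₃ : 0 ≤ r₃) (hNov : 0 ≤ Nov)
    -- the partition: sizes, fit, overlap
    (hh : ∀ i x, |h i x| ≤ 1) (hh' : ∀ i x', |h' i x'| ≤ 1) (hfit : ∀ i x', |h' i x' - h i (π x')| ≤ o) (hN : ∀ a, ∑ i, ind (S i) a ≤ Nov)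
    -- the first-order left factor `D`: two-term Leibniz data at both spacings
    (hleib : ∀ i, D ∘ₗ mulOp (h i) = mulOp (hs i) ∘ₗ D + mulOp (dh i)) (hleib' : ∀ i, D' ∘ₗ mulOp (h' i) = mulOp (hs' i) ∘ₗ D' + mulOp (dh' i))
    (hhs' : ∀ i x', |hs' i x'| ≤ cs) (hdh' : ∀ i x', |dh' i x'| ≤ cd) (hfits : ∀ i x', |hs' i x' - hs i (π x')| ≤ os) (hfitd : ∀ i x', |dh' i x' - dh i (π x')| ≤ od)
    -- the first-order right factor `E`
    (hleibE : ∀ i, mulOp (h i) ∘ₗ E = E ∘ₗ mulOp (hsE i) + mulOp (dhE i)) (hleibE' : ∀ i, mulOp (h' i) ∘ₗ E' = E' ∘ₗ mulOp (hsE' i) + mulOp (dhE' i))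
    (hhsE : ∀ i x, |hsE i x| ≤ csE) (hdhE : ∀ i x, |dhE i x| ≤ cdE) (hfitsE : ∀ i x', |hsE' i x' - hsE i (π x')| ≤ osE) (hfitdE : ∀ i x', |dhE' i x' - dhE i (π x')| ≤ odE)
    -- cube entries 0–3 at both spacings
    (hG : ∀ i, HasMaj (BlockNorm.ofBlocks g blk) (BlockNorm.ofBlocks g blk) (G i) (fun y y' => ind (S i) y * ind (S i) y' * (β * Real.exp (-(δ * g.dist y y')))))
    (hG' : ∀ i, HasMaj (BlockNorm.ofBlocks g (blk ∘ π)) (BlockNorm.ofBlocks g (blk ∘ π)) (G' i)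
      (fun y y' => ind (S i) y * ind (S i) y' * (β * Real.exp (-(δ * g.dist y y')))))
    (hDG : ∀ i, HasMaj (BlockNorm.ofBlocks g blk) (BlockNorm.ofBlocks g blk) (D ∘ₗ G i) (fun y y' => ind (S i) y * ind (S i) y' * (β₁ * Real.exp (-(δ * g.dist y y')))))
    (hDG' : ∀ i, HasMaj (BlockNorm.ofBlocks g (blk ∘ π)) (BlockNorm.ofBlocks g (blk ∘ π)) (D' ∘ₗ G' i)
      (fun y y' => ind (S i) y * ind (S i) y' * (β₁ * Real.exp (-(δ * g.dist y y')))))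
    (hGE : ∀ i, HasMaj (BlockNorm.ofBlocks g blk) (BlockNorm.ofBlocks g blk) (G i ∘ₗ E) (fun y y' => ind (S i) y * ind (S i) y' * (β₂ * Real.exp (-(δ * g.dist y y')))))
    (hGE' : ∀ i, HasMaj (BlockNorm.ofBlocks g (blk ∘ π)) (BlockNorm.ofBlocks g (blk ∘ π)) (G' i ∘ₗ E')
      (fun y y' => ind (S i) y * ind (S i) y' * (β₂ * Real.exp (-(δ * g.dist y y')))))
    (hG3 : ∀ i, HasMaj (BlockNorm.ofBlocks g blk) (BlockNorm.ofBlocks g blk) (D₃ ∘ₗ G i) (fun y y' => ind (S i) y * ind (S i) y' * (β₃ * Real.exp (-(δ * g.dist y y')))))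
    (hG3' : ∀ i, HasMaj (BlockNorm.ofBlocks g (blk ∘ π)) (BlockNorm.ofBlocks g (blk ∘ π)) (D₃' ∘ₗ G' i)
      (fun y y' => ind (S i) y * ind (S i) y' * (β₃ * Real.exp (-(δ * g.dist y y')))))
    -- the remainder's commutator rows, both arrangements, and entry 3's
    (hKc : ∀ i, HasMaj (BlockNorm.ofBlocks g blk) (BlockNorm.ofBlocks g blk) (commOp Δ (h i) ∘ₗ G i) (fun y y' => ind (S i) y * ind (S i) y' * (θ₀ * Real.exp (-(δ * g.dist y y')))))
    (hKc' : ∀ i, HasMaj (BlockNorm.ofBlocks g (blk ∘ π)) (BlockNorm.ofBlocks g (blk ∘ π)) (commOp Δ' (h' i) ∘ₗ G' i)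
      (fun y y' => ind (S i) y * ind (S i) y' * (θ₀ * Real.exp (-(δ * g.dist y y')))))
    (hKcL : ∀ i, HasMaj (BlockNorm.ofBlocks g blk) (BlockNorm.ofBlocks g blk) (G i ∘ₗ commOp Δ (h i)) (fun y y' => ind (S i) y * ind (S i) y' * (θ₀ * Real.exp (-(δ * g.dist y y')))))
    (hKcL' : ∀ i, HasMaj (BlockNorm.ofBlocks g (blk ∘ π)) (BlockNorm.ofBlocks g (blk ∘ π)) (G' i ∘ₗ commOp Δ' (h' i))
      (fun y y' => ind (S i) y * ind (S i) y' * (θ₀ * Real.exp (-(δ * g.dist y y')))))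
    (hK3' : ∀ i, HasMaj (BlockNorm.ofBlocks g (blk ∘ π)) (BlockNorm.ofBlocks g (blk ∘ π)) (commOp D₃' (h' i) ∘ₗ G' i)
      (fun y y' => ind (S i) y * ind (S i) y' * (θ₃ * Real.exp (-(δ * g.dist y y')))))
    -- two-grid defects of all rows
    (hIG : ∀ i, HasMaj (BlockNorm.ofBlocks g blk) (BlockNorm.ofBlocks g (blk ∘ π)) (idef (pull π) (pull π) (G' i) (G i))
      (fun y y' => ind (S i) y * ind (S i) y' * (m₀ * Real.exp (-(δ * g.dist y y')))))
    (hIDG : ∀ i, HasMaj (BlockNorm.ofBlocks g blk) (BlockNorm.ofBlocks g (blk ∘ π)) (idef (pull π) (pull π) (D' ∘ₗ G' i) (D ∘ₗ G i))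
      (fun y y' => ind (S i) y * ind (S i) y' * (m₁ * Real.exp (-(δ * g.dist y y')))))
    (hIGE : ∀ i, HasMaj (BlockNorm.ofBlocks g blk) (BlockNorm.ofBlocks g (blk ∘ π)) (idef (pull π) (pull π) (G' i ∘ₗ E') (G i ∘ₗ E))
      (fun y y' => ind (S i) y * ind (S i) y' * (m₂ * Real.exp (-(δ * g.dist y y')))))
    (hIG3 : ∀ i, HasMaj (BlockNorm.ofBlocks g blk) (BlockNorm.ofBlocks g (blk ∘ π)) (idef (pull π) (pull π) (D₃' ∘ₗ G' i) (D₃ ∘ₗ G i))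
      (fun y y' => ind (S i) y * ind (S i) y' * (m₃ * Real.exp (-(δ * g.dist y y')))))
    (hDK : ∀ i, HasMaj (BlockNorm.ofBlocks g blk) (BlockNorm.ofBlocks g (blk ∘ π)) (idef (pull π) (pull π) (commOp Δ' (h' i) ∘ₗ G' i) (commOp Δ (h i) ∘ₗ G i))
      (fun y y' => ind (S i) y * ind (S i) y' * (r₀ * Real.exp (-(δ * g.dist y y')))))
    (hDKL : ∀ i, HasMaj (BlockNorm.ofBlocks g blk) (BlockNorm.ofBlocks g (blk ∘ π)) (idef (pull π) (pull π) (G' i ∘ₗ commOp Δ' (h' i)) (G i ∘ₗ commOp Δ (h i)))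
      (fun y y' => ind (S i) y * ind (S i) y' * (r₀ * Real.exp (-(δ * g.dist y y')))))
    (hDK3 : ∀ i, HasMaj (BlockNorm.ofBlocks g blk) (BlockNorm.ofBlocks g (blk ∘ π)) (idef (pull π) (pull π) (commOp D₃' (h' i) ∘ₗ G' i) (commOp D₃ (h i) ∘ₗ G i))
      (fun y y' => ind (S i) y * ind (S i) y' * (r₃ * Real.exp (-(δ * g.dist y y'))))) :
    GluedLetters blk π (parametrix h G) (remainder Δ h G) (remainderL Δ h G) D D₃ E (parametrix h' G') (remainder Δ' h' G') (remainderL Δ' h' G') D' D₃' E'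
      (Nov * (β + (cs * β₁ + cd * β) + (β₂ * csE + β * cdE) + (β₃ + θ₃))) (Nov * θ₀)
      (Nov * ((2 * β * o + m₀) + (cs * (β₁ * o + m₁) + os * β₁ + cd * (β * o + m₀) + od * β) +
        (β₂ * osE + m₂ * csE + o * β₂ * csE + β * odE + m₀ * cdE + o * β * cdE) + (2 * β₃ * o + m₃ + θ₃ * o + r₃)))
      (Nov * (θ₀ * o + r₀)) δ := by
  -- nonnegativity of the four summands of `A` and of `m`
  have hA1 : 0 ≤ cs * β₁ + cd * β := by positivity
  have hA2 : 0 ≤ β₂ * csE + β * cdE := by positivity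
  have hA3 : 0 ≤ β₃ + θ₃ := by positivity
  have hM0 : 0 ≤ 2 * β * o + m₀ := by positivity
  have hM1 : 0 ≤ cs * (β₁ * o + m₁) + os * β₁ + cd * (β * o + m₀) + od * β := by positivity
  have hM2 : 0 ≤ β₂ * osE + m₂ * csE + o * β₂ * csE + β * odE + m₀ * cdE + o * β * cdE := by positivity
  have hM3 : 0 ≤ 2 * β₃ * o + m₃ + θ₃ * o + r₃ := by positivity
  refine ⟨?_, ?_, ?_, ?_, ?_, ?_, ?_, ?_, ?_, ?_, ?_, ?_, ?_, ?_⟩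
  · exact (hasMaj_parametrix (blk ∘ π) S hβ hh' hN hG').mono fun y y' => const_mono_exp hNov (by linarith) y y'
  · exact (hasMaj_comp_parametrix (blk ∘ π) S hβ hβ₁ hcs hcd hleib' hh' hhs' hdh' hN hG' hDG').mono fun y y' => const_mono_exp hNov (by linarith) y y'
  · exact (hasMaj_parametrix_comp blk S hβ hβ₂ hcsE hcdE hleibE hh hhsE hdhE hN hG hGE).mono fun y y' => const_mono_exp hNov (by linarith) y y'
  · exact (hasMaj_comp_parametrix_of_commOp (blk ∘ π) S hβ₃ hθ₃ hh' hN hG3' hK3').mono fun y y' => const_mono_exp hNov (by linarith) y y'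
  · exact hasMaj_remainder blk S hθ hh hN hKc
  · exact hasMaj_remainder (blk ∘ π) S hθ hh' hN hKc'
  · exact hasMaj_remainderL blk S hθ hh hN hKcL
  · exact hasMaj_remainderL (blk ∘ π) S hθ hh' hN hKcL'
  · exact (hasMaj_idef_parametrix blk π S hβ hm₀ ho hh hh' hfit hN hG hG' hIG).mono fun y y' => const_mono_exp hNov (by linarith) y y'
  · exact (hasMaj_idef_comp_parametrix blk π S hβ hβ₁ hcs hcd ho hos hod hm₀ hm₁ hleib hleib' hh hhs' hdh' hfit hfits hfitd hN hG hG' hDG hDG' hIG hIDG).mono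
      fun y y' => const_mono_exp hNov (by linarith) y y'
  · exact (hasMaj_idef_parametrix_comp blk π S hβ hβ₂ hcsE hcdE ho hosE hodE hm₀ hm₂ hleibE hleibE' hh' hhsE hdhE hfit hfitsE hfitdE hN hG hG' hGE hGE' hIG hIGE).mono
      fun y y' => const_mono_exp hNov (by linarith) y y'
  · exact (hasMaj_idef_comp_parametrix_of_commOp blk π S hβ₃ hθ₃ ho hm₃ hr₃ hh hh' hfit hN hG3 hG3' hK3' hIG3 hDK3).mono fun y y' => const_mono_exp hNov (by linarith) y y'
  · exact hasMaj_idef_remainder blk π S hθ hr₀ ho hh hfit hN hKc' hDK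
  · exact (hasMaj_idef_remainderL blk π S hθ hr₀ ho hh' hfit hN hKcL hDKL).mono fun y y' => const_mono_exp hNov (by linarith) y y'

end Bundle

end Summit.QuantumFields.YangMills.BalabanUVNodes.N15.Gluing

end
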